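import Literature.AlgebraicGeometry.Frobenioids.Thm42SubProofsIII
import Literature.AlgebraicGeometry.Frobenioids.Thm42SubProofsL10
import Literature.AlgebraicGeometry.Frobenioids.Thm42PrimesCompatiblePullback
import Literature.AlgebraicGeometry.Frobenioids.Thm42PrimaryStepsPropagation
import Literature.AlgebraicGeometry.Frobenioids.PrimaryStepsPrimeClasses
import Literature.AlgebraicGeometry.Frobenioids.MonoidTransport
import Literature.AlgebraicGeometry.Frobenioids.PreFrobenioidPullbacks
import Literature.AlgebraicGeometry.Frobenioids.Composites
import HarnessLib

/-!
# [FrdI] Theorem 4.2 (ii): the compatibility square `FrdI.T42.PrimesCompatibleAlong` — closers with that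
# conclusion head along morphisms of Frobenius type, pre-steps, and all base-isomorphisms

Mochizuki, *The geometry of Frobenioids I: the general theory*, Kyushu J. Math. **62** (2008)
293–400, §4, Theorem 4.2 (ii), proof p. 80 l. 34 – p. 81 l. 4 [cite: MochizukiFrdI2008, Thm. 4.2 (ii) p.80]:
"`Ψ^Prime(−)` is compatible (with the evident functoriality of `Prime(Φ₁(−))`, `Prime(Φ₂(−))`) with respect to
morphisms of Frobenius type … [and] with respect to pre-steps", i.e. (Prop. 1.7 (ii): a base-isomorphism is a
composite (Frobenius type) then (pre-step)) `Ψ^Prime` is functorial on `C^bs-iso`.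

PROOF-ONLY file (abc-iut cell, D-0079 L-F [FrdI/II] pack C, FACT-LIST row F-2651 = the predicate
`FrdI.T42.PrimesCompatibleAlong F₁ F₂ Ψ e γ` of `Thm42SubII.lean`, seat abc-iut-L1-t14; this file seat
abc-iut-L1-t11). No definition, nothing restated. The two printed cases are the landed 0-ary rows
`FrdI.T42.PsiPrimeFunctorialFrobeniusType_holds` (T42-L09, `Thm42SubProofsIII.lean`) and
`FrdI.T42.psiPrimeFunctorialPreStep_holds` (T42-L10, `Thm42SubProofsL10.lean`); here they are re-headed BY NAME so
that the conclusion head is the row's declaration, with their hypothesis "`Ψ` preserves primary pre-steps"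
discharged inside the setting of Thm. 4.2 (`FrdI.T42.Setting.isPrimaryPreStep_map`,
`Thm42PrimaryStepsPropagation.lean`):

* `primesCompatibleAlong_of_isFrobeniusType`, `primesCompatibleAlong_of_isPreStep` — in the setting of the
  proof of Thm. 4.2 (`FrdI.T42.Setting F₁ F₂ Ψ`, p. 78 ll. 28–46), every family `e` with the clause of row L08
  (primary steps into `A` with zero divisor in `𝔭` go to primary steps with zero divisor in `e A 𝔭`) is
  compatible along every morphism of Frobenius type and along every pre-step of `C₁`;
* `PrimesCompatibleAlong.comp` — compatibility squares compose along `γ₁ ≫ γ₂` whenever `Base(γ₂)` and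
  `Base(Ψ γ₁)` are isomorphisms (pull-back along an isomorphism of `D` carries the subset of a prime onto the
  subset of a prime, §0 p. 12 / `Primes.congr`);
* `primesCompatibleAlong_of_isBaseIso` — hence along EVERY base-isomorphism `γ` (Prop. 1.7 (ii),
  `PreFrobenioid.isBaseIso_iff_exists_frobeniusType_preStep`): the functoriality of `Ψ^Prime` on `C^bs-iso`.

The universal closure of the bare predicate over its free binders is refuted in
`Thm42PrimesCompatibleSchemaClosure.lean` (junk structures); the above is the instance form print asserts.
Nothing here bears on [IUTchIII] or takes a side; [FrdI] is refereed and undisputed.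
-/

namespace Literature.AlgebraicGeometry.Frobenioids

open CategoryTheory Opposite

namespace FrdI.T42

universe w v v' u u'

variable {D₁ : Type u} [Category.{v} D₁] {Φ₁ : D₁ᵒᵖ ⥤ CommMonCat.{w}} {C₁ : Type u'} [Category.{v'} C₁]
  {D₂ : Type u} [Category.{v} D₂] {Φ₂ : D₂ᵒᵖ ⥤ CommMonCat.{w}} {C₂ : Type u'} [Category.{v'} C₂]
  {F₁ : C₁ ⥤ ElemFrobenioid Φ₁} {F₂ : C₂ ⥤ ElemFrobenioid Φ₂} {Ψ : C₁ ≌ C₂}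

/-! ### Pull-back along an isomorphism of the base and the subsets of primes (§0 p. 12) -/

/-- For an isomorphism `θ : B ⥲ A` of `D`, the pull-back `θ^* : Φ(A) ⥲ Φ(B)` carries the subset `𝔭 ⊆ Φ(A)` of
a prime into the subset of the transported prime `Prime(θ^*)(𝔭) ⊆ Φ(B)`.
[cite: MochizukiFrdI2008, §0 p.12] -/
theorem pull_mem_carrier_congr_pullEquiv {D : Type u} [Category.{v} D] (Φ : Dᵒᵖ ⥤ CommMonCat.{w})
    {A B : D} (θ : B ⟶ A) [IsIso θ] (𝔭 : Primes (Φ.obj (op A))) {x : Φ.obj (op A)}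
    (hx : x ∈ 𝔭.carrier) :
    pull Φ θ x ∈ (Primes.congr (ElemFrobenioid.pullEquiv Φ θ) 𝔭).carrier := by
  rw [Primes.mem_carrier_congr_iff]
  have h : (ElemFrobenioid.pullEquiv Φ θ).symm (pull Φ θ x) = x :=
    (ElemFrobenioid.pullEquiv Φ θ).symm_apply_apply x
  rw [h]
  exact hx

/-- For an isomorphism `θ : B ⥲ A` of `D`, if `θ^*` carries SOME element of the subset of the prime `𝔮 ⊆ Φ(A)`
into the subset of the prime `𝔯 ⊆ Φ(B)`, then it carries ALL of `𝔮` into `𝔯` (a primary element lies in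
exactly one prime). [cite: MochizukiFrdI2008, §0 p.12] -/
theorem pull_mem_carrier_of_pull_mem_carrier {D : Type u} [Category.{v} D] (Φ : Dᵒᵖ ⥤ CommMonCat.{w})
    {A B : D} (θ : B ⟶ A) [IsIso θ] {𝔮 : Primes (Φ.obj (op A))} {𝔯 : Primes (Φ.obj (op B))}
    {q y : Φ.obj (op A)} (hq : q ∈ 𝔮.carrier) (hqr : pull Φ θ q ∈ 𝔯.carrier) (hy : y ∈ 𝔮.carrier) :
    pull Φ θ y ∈ 𝔯.carrier := by
  have h𝔯 : Primes.congr (ElemFrobenioid.pullEquiv Φ θ) 𝔮 = 𝔯 :=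
    Primes.eq_of_mem_carrier (pull_mem_carrier_congr_pullEquiv Φ θ 𝔮 hq) hqr
  rw [← h𝔯]
  exact pull_mem_carrier_congr_pullEquiv Φ θ 𝔮 hy

/-! ### Composition of compatibility squares -/

/-- **Compatibility squares compose**: if the family `e` is compatible with `Prime(Φ₁(−))`, `Prime(Φ₂(−))` along
`γ₁ : A → X` and along `γ₂ : X → A'`, and `Base(γ₂)`, `Base(Ψ γ₁)` are isomorphisms of the bases (e.g. `γ₁`,
`γ₂` base-isomorphisms and `Ψ` as in Thm. 3.4 (iii)), then `e` is compatible along `γ₁ ≫ γ₂` — the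
"evident functoriality of `Prime(Φ_i(−))`" on `C^bs-iso` (p. 80 l. 35). [cite: MochizukiFrdI2008, Thm. 4.2 (ii) p.80] -/
theorem PrimesCompatibleAlong.comp
    (e : ∀ A : C₁, Primes (Φ₁.obj (op (PreFrobenioid.baseObj F₁ A))) ≃
      Primes (Φ₂.obj (op (PreFrobenioid.baseObj F₂ (Ψ.functor.obj A)))))
    {A X A' : C₁} {γ₁ : A ⟶ X} {γ₂ : X ⟶ A'}
    (hγ₂ : PreFrobenioid.IsBaseIso F₁ γ₂) (hΨγ₁ : PreFrobenioid.IsBaseIso F₂ (Ψ.functor.map γ₁))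
    (h₁ : PrimesCompatibleAlong F₁ F₂ Ψ e γ₁) (h₂ : PrimesCompatibleAlong F₁ F₂ Ψ e γ₂) :
    PrimesCompatibleAlong F₁ F₂ Ψ e (γ₁ ≫ γ₂) := by
  intro 𝔭 𝔭' h𝔭
  obtain ⟨p', hp', hpull⟩ := h𝔭
  rw [PreFrobenioid.base_comp, pull_comp] at hpull
  haveI : IsIso (PreFrobenioid.Base F₁ γ₂) := hγ₂
  haveI : IsIso (PreFrobenioid.Base F₂ (Ψ.functor.map γ₁)) := hΨγ₁
  -- the intermediate prime `𝔭'' ⊆ Φ₁(Base X)` of `Base(γ₂)^*(p')`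
  have hx : pull Φ₁ (PreFrobenioid.Base F₁ γ₂) p' ∈
      (Primes.congr (ElemFrobenioid.pullEquiv Φ₁ (PreFrobenioid.Base F₁ γ₂)) 𝔭').carrier :=
    pull_mem_carrier_congr_pullEquiv Φ₁ (PreFrobenioid.Base F₁ γ₂) 𝔭' hp'
  obtain ⟨q', hq', hq'pull⟩ := h₂ _ 𝔭' ⟨p', hp', hx⟩
  obtain ⟨q'', hq'', hq''pull⟩ := h₁ 𝔭 _ ⟨_, hx, hpull⟩
  refine ⟨q', hq', ?_⟩
  rw [Functor.map_comp, PreFrobenioid.base_comp, pull_comp]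
  exact pull_mem_carrier_of_pull_mem_carrier Φ₂ (PreFrobenioid.Base F₂ (Ψ.functor.map γ₁)) hq'' hq''pull
    hq'pull

/-! ### The printed cases: morphisms of Frobenius type, pre-steps (p. 80 l. 34 – p. 81 l. 4) -/

section Setting

variable (S : Setting F₁ F₂ Ψ)
  (e : ∀ A : C₁, Primes (Φ₁.obj (op (PreFrobenioid.baseObj F₁ A))) ≃
    Primes (Φ₂.obj (op (PreFrobenioid.baseObj F₂ (Ψ.functor.obj A)))))
  (he : ∀ (A : C₁) ⦃E : C₁⦄ (ε : E ⟶ A) (hε : PreFrobenioid.IsPrimaryPreStep F₁ ε)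
    (𝔭 : Primes (Φ₁.obj (op (PreFrobenioid.baseObj F₁ A)))),
    PreFrobenioid.invDiv F₁ ε hε.1.2 ∈ 𝔭.carrier →
      ∀ h₂ : PreFrobenioid.IsBaseIso F₂ (Ψ.functor.map ε),
        PreFrobenioid.invDiv F₂ (Ψ.functor.map ε) h₂ ∈ (e A 𝔭).carrier)

include S he

/-- **[FrdI] Thm. 4.2 (ii), row T42-L09 re-headed** (p. 80 ll. 34–43): in the setting of the proof of
Thm. 4.2, every family `e` with the clause of row L08 is compatible with `Prime(Φ₁(−))`, `Prime(Φ₂(−))` along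
every morphism of FROBENIUS TYPE `γ` of `C₁`. By name from `FrdI.T42.PsiPrimeFunctorialFrobeniusType_holds`,
the hypothesis "`Ψ` preserves primary pre-steps" being `FrdI.T42.Setting.isPrimaryPreStep_map`.
[cite: MochizukiFrdI2008, Thm. 4.2 (ii) p.80] -/
theorem primesCompatibleAlong_of_isFrobeniusType {A A' : C₁} (γ : A ⟶ A')
    (hγ : PreFrobenioid.IsFrobeniusType F₁ γ) :
    Literature.AlgebraicGeometry.Frobenioids.FrdI.T42.PrimesCompatibleAlong F₁ F₂ Ψ e γ :=
  PsiPrimeFunctorialFrobeniusType_holds F₁ F₂ Ψ S (fun _ _ _ h => S.isPrimaryPreStep_map h) e he γ hγ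

/-- **[FrdI] Thm. 4.2 (ii), row T42-L10 re-headed** (p. 80 l. 44 – p. 81 l. 4): in the setting of the proof
of Thm. 4.2, every family `e` with the clause of row L08 is compatible with `Prime(Φ₁(−))`, `Prime(Φ₂(−))`
along every PRE-STEP `γ` of `C₁`. By name from `FrdI.T42.psiPrimeFunctorialPreStep_holds`.
[cite: MochizukiFrdI2008, Thm. 4.2 (ii) p.80] -/
theorem primesCompatibleAlong_of_isPreStep {A A' : C₁} (γ : A ⟶ A') (hγ : PreFrobenioid.IsPreStep F₁ γ) :
    Literature.AlgebraicGeometry.Frobenioids.FrdI.T42.PrimesCompatibleAlong F₁ F₂ Ψ e γ :=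
  psiPrimeFunctorialPreStep_holds F₁ F₂ Ψ S (fun _ _ _ h => S.isPrimaryPreStep_map h) e he γ hγ

/-- **[FrdI] Thm. 4.2 (ii): `Ψ^Prime(−)` is functorial on `C^bs-iso`** (p. 80 l. 34 – p. 81 l. 4 with
Prop. 1.7 (ii)): in the setting of the proof of Thm. 4.2, every family `e` with the clause of row L08 is
compatible with `Prime(Φ₁(−))`, `Prime(Φ₂(−))` along EVERY BASE-ISOMORPHISM `γ` of `C₁` — `γ = β ≫ α` with `β`
of Frobenius type and `α` a pre-step (`PreFrobenioid.isBaseIso_iff_exists_frobeniusType_preStep`), and the two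
printed cases compose (`PrimesCompatibleAlong.comp`; `Base(Ψ β)` is an isomorphism by Thm. 3.4 (iii), a field
of the setting). [cite: MochizukiFrdI2008, Thm. 4.2 (ii) p.80] -/
theorem primesCompatibleAlong_of_isBaseIso {A A' : C₁} (γ : A ⟶ A') (hγ : PreFrobenioid.IsBaseIso F₁ γ) :
    Literature.AlgebraicGeometry.Frobenioids.FrdI.T42.PrimesCompatibleAlong F₁ F₂ Ψ e γ := by
  obtain ⟨X, β, α, hfac, hβ, hα⟩ :=
    (PreFrobenioid.isBaseIso_iff_exists_frobeniusType_preStep F₁ S.isFrobenioid₁ γ).mp hγ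
  subst hfac
  exact PrimesCompatibleAlong.comp e hα.2 (S.frobeniusType_map β hβ).2
    (primesCompatibleAlong_of_isFrobeniusType S e he β hβ) (primesCompatibleAlong_of_isPreStep S e he α hα)

end Setting

end FrdI.T42

end Literature.AlgebraicGeometry.Frobenioids
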